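import Summits.RiemannHypothesis.RiemannHypothesis.Theorems.HandoffCross
import Literature.NumberTheory.LFunctions.WeilSemilocalEventuallyNegative
import Literature.NumberTheory.LFunctions.WeilDilationVirial
import HarnessLib

/-!
# HANDOFF, edge block: a scaled bump with an explicit `log(1/r)` energy ceiling (rh-explicit, track «HANDOFF», seat prove-2 gen2, ATTEMPT-7 §5)

HONEST FRAMING. Nothing here bears on RH. This file supplies the ONE analytic estimate that ATTEMPT-7's odd witness needs and that
`HandoffEdgeOdd.not_edgeNonnegOdd_of_witness` leaves open: an UPPER bound for the Weil energy of a narrow bump, with the correct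
leading term `log(1/r)` and an (unevaluated but finite) additive constant.

* `reDigammaQuarter_le_log_add_three` — `Re ψ(1/4 + it/2) ≤ log(1 + |t|) + 3` (Gauss–Stirling upper bound of the tree,
  `re_digamma_le_log_norm_add`, plus monotonicity in `|t|`) (PROVED).
* `cramerBump r x₀ = φ₀((· − x₀)/r)` — Mathlib's normalised smooth bump `φ₀ = moll 0` (radius `1`, `∫φ₀ = 1`, `φ₀ ≥ 0`) squeezed to
  radius `r` and moved to `x₀`; a Weil test function supported in `[x₀ − r, x₀ + r]`, with `∫‖·‖² = r·‖φ₀‖₂²` and Mellin transform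
  `e^{(s−½)x₀}·r·φ̂₀(½ + r(s − ½))` (PROVED).
* `normSq_weilMellin_cramerBump_one_ge` — `|f̂(1)|² ≥ e^{x₀ − 1}·r²` (PROVED): the polar mass the ODD sector cannot compensate.
* `re_weilQuadratic_cramerBump_le` — **`Re Q(f) ≤ (log(1/r) + cramerEnergyConst)·∫‖f‖²`** for `0 < r ≤ 1/4` (PROVED), where
  `cramerEnergyConst = 3 + 4e + L_φ/π`, `L_φ = ∫‖φ̂₀(½+iu)‖² log(1+|u|) du` (a finite, unevaluated constant of Mathlib's unspecified bump).
  (translation invariance, `Re Q = E` below width `log 2`, the majorant `ρ ≤ log(1+|t|) + 3`, Plancherel, one change of variables).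
-/

set_option linter.dupNamespace false

noncomputable section

open Complex Filter Set MeasureTheory Literature.NumberTheory.LFunctions
  Literature.NumberTheory.LFunctions.WeilContinuous Literature.NumberTheory.LFunctions.TwoBump
open scoped Real Topology ComplexConjugate ContDiff

namespace Summit.RiemannHypothesis.RiemannHypothesis.Theorems.Handoff

/-! ## §1 An explicit logarithmic majorant of the archimedean weight -/

/-- `Re ψ(1/4 + it/2) ≤ log(1 + |t|) + 3` for every real `t`. For `|t| ≥ 2` this is the Gauss–Stirling bound
`Re ψ(w) ≤ log‖w‖ + 1/(2‖w‖²) + π/(4|Im w|)` at `w = 1/4 + it/2` (`‖w‖ ∈ [|t|/2, 1 + |t|]`); for `|t| ≤ 2` monotonicity in `|t|`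
reduces to `t = 2`. [folklore] -/
theorem reDigammaQuarter_le_log_add_three (t : ℝ) :
    Literature.Analysis.SpecialFunctions.reDigammaQuarter t ≤ Real.log (1 + |t|) + 3 := by
  have key : ∀ u : ℝ, 2 ≤ |u| →
      Literature.Analysis.SpecialFunctions.reDigammaQuarter u ≤ Real.log (1 + |u|) + 1.3 := by
    intro u hu
    set w : ℂ := 1 / 4 + (u : ℂ) / 2 * I with hw
    have hre : w.re = 1 / 4 := by simp [hw]
    have him : w.im = u / 2 := by simp [hw]
    have hw0 : 0 < w.re := by rw [hre]; norm_num
    have hwi : w.im ≠ 0 := by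
      rw [him]
      intro h
      have hu0 : u = 0 := by linarith
      rw [hu0, abs_zero] at hu
      linarith
    have h := Literature.Analysis.SpecialFunctions.Complex.re_digamma_le_log_norm_add hw0 hwi
    have hnorm_ge : |u| / 2 ≤ ‖w‖ := by
      have := Complex.abs_im_le_norm w
      rwa [him, abs_div, abs_two] at this
    have hnorm_le : ‖w‖ ≤ 1 + |u| := by
      have h1 := Complex.norm_le_abs_re_add_abs_im w
      rw [hre, him] at h1
      have e1 : |(1 : ℝ) / 4| = 1 / 4 := abs_of_pos (by norm_num)
      have e2 : |u / 2| = |u| / 2 := by rw [abs_div, abs_two]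
      rw [e1, e2] at h1
      linarith [abs_nonneg u]
    have hw1 : 1 ≤ ‖w‖ := by linarith
    have hwpos : 0 < ‖w‖ := by linarith
    have hlog : Real.log ‖w‖ ≤ Real.log (1 + |u|) := Real.log_le_log hwpos hnorm_le
    have h2 : 1 / (2 * ‖w‖ ^ 2) ≤ 1 / 2 := by
      rw [div_le_div_iff₀ (by positivity) (by norm_num)]; nlinarith
    have h3 : π / (4 * |w.im|) ≤ π / 4 := by
      rw [him, abs_div, abs_two]
      refine div_le_div_of_nonneg_left Real.pi_pos.le (by norm_num) ?_
      linarith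
    have hdef : Literature.Analysis.SpecialFunctions.reDigammaQuarter u = (Complex.digamma w).re := rfl
    rw [hdef]
    linarith [Real.pi_lt_d2]
  rcases le_or_gt 2 |t| with ht | ht
  · linarith [key t ht]
  · have hmono := Literature.Analysis.SpecialFunctions.reDigammaQuarter_mono (t := 2) (u := t)
      (by rw [abs_of_pos (by norm_num : (0:ℝ) < 2)]; exact ht.le)
    have h2 := key 2 (by rw [abs_of_pos (by norm_num : (0:ℝ) < 2)])
    rw [abs_of_pos (by norm_num : (0:ℝ) < 2), show (1 : ℝ) + 2 = 3 by norm_num] at h2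
    have hl3 : Real.log 3 ≤ 1.4 := by
      have h4 : Real.log 3 ≤ Real.log (2 ^ 2) := Real.log_le_log (by norm_num) (by norm_num)
      rw [Real.log_pow] at h4
      have := Real.log_two_lt_d9
      push_cast at h4
      linarith
    have h0 : 0 ≤ Real.log (1 + |t|) := Real.log_nonneg (by linarith [abs_nonneg t])
    linarith

/-! ## §2 The profile `φ₀ = moll 0` and its constants -/

/-- `tsupport φ₀ ⊆ [−1, 1]`. [folklore] -/
theorem tsupport_moll_zero_subset : tsupport (moll 0) ⊆ Icc (-1 : ℝ) 1 := by
  refine closure_minimal (fun x hx ↦ ?_) isClosed_Icc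
  rw [Function.mem_support] at hx
  by_contra hx'
  apply hx
  apply moll_zero_eq_zero
  rw [Set.mem_Icc, not_and_or, not_le, not_le] at hx'
  rcases hx' with h | h
  · rw [abs_of_neg (by linarith)]; linarith
  · rw [abs_of_pos (by linarith)]; linarith

/-- `‖φ₀‖₂² ≥ 1/2` (Cauchy–Schwarz on `[−1, 1]`: `1 = (∫‖φ₀‖)² ≤ 2·∫‖φ₀‖²`). [folklore] -/
theorem half_le_weilNorm2Sq_moll_zero : 1 / 2 ≤ weilNorm2Sq (moll 0) := by
  have h := sq_integral_norm_le_length_mul (isWeilTest_moll 0) (by norm_num : (-1 : ℝ) ≤ 1) tsupport_moll_zero_subset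
  rw [integral_norm_moll] at h
  unfold weilNorm2Sq
  linarith

/-- The log-moment of the profile: `L_φ = ∫ ‖φ̂₀(½ + iu)‖² log(1 + |u|) du` (finite: `‖φ̂₀‖²` decays like `(1+u²)⁻²`). [folklore] -/
def mollLogMoment : ℝ :=
  ∫ u : ℝ, ‖weilMellin (moll 0) (1 / 2 + u * I)‖ ^ 2 * Real.log (1 + |u|)

/-- `L_φ ≥ 0`. [folklore] -/
theorem mollLogMoment_nonneg : 0 ≤ mollLogMoment :=
  integral_nonneg fun u ↦ mul_nonneg (sq_nonneg _) (Real.log_nonneg (by linarith [abs_nonneg u]))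

/-- The log weight has quadratic growth: `|log(1 + |u|)| ≤ 1 + u²`. [folklore] -/
theorem abs_log_one_add_abs_le (u : ℝ) : |Real.log (1 + |u|)| ≤ 1 + 1 * u ^ 2 := by
  have h0 : 0 ≤ Real.log (1 + |u|) := Real.log_nonneg (by linarith [abs_nonneg u])
  rw [abs_of_nonneg h0]
  have h1 := Real.log_le_sub_one_of_pos (by linarith [abs_nonneg u] : (0:ℝ) < 1 + |u|)
  nlinarith [abs_nonneg u, sq_abs u, sq_nonneg (|u| - 1)]

/-- Integrability of `‖ĝ(½+iu)‖²·log(1+|u|)` for a Weil test function. [folklore] -/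
theorem integrable_norm_sq_weilMellin_mul_log {g : ℝ → ℂ} (hg : IsWeilTest g) :
    Integrable fun u : ℝ ↦ ‖weilMellin g (1 / 2 + u * I)‖ ^ 2 * Real.log (1 + |u|) :=
  integrable_norm_sq_weilMellin_mul hg ((Real.measurable_log.comp (measurable_const.add measurable_abs)))
    (by norm_num) (by norm_num) abs_log_one_add_abs_le

/-- The additive constant of the energy ceiling: `3 + 4e + L_φ/π`. [this track, ATTEMPT-7 §5] -/
def cramerEnergyConst : ℝ :=
  3 + 4 * Real.exp 1 + mollLogMoment / π

/-- `Re φ̂₀(σ) ≥ e^{−1/2}` for real `σ` with `|σ − ½| ≤ ½` (`φ₀ ≥ 0`, `∫φ₀ = 1`, `supp φ₀ ⊆ [−1, 1]`). [folklore] -/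
theorem exp_neg_half_le_re_weilMellin_moll_zero_real {σ : ℝ} (hσ : |σ - 1 / 2| ≤ 1 / 2) :
    Real.exp (-(1 / 2)) ≤ (weilMellin (moll 0) (σ : ℂ)).re := by
  set φ : ℝ → ℝ := (bump 0).normed volume with hφ
  have e : (fun t : ℝ ↦ moll 0 t * cexp (((σ : ℂ) - 1 / 2) * (t : ℂ))) =
      fun t : ℝ ↦ ((φ t * Real.exp ((σ - 1 / 2) * t) : ℝ) : ℂ) := by
    funext t
    rw [show ((σ : ℂ) - 1 / 2) * (t : ℂ) = (((σ - 1 / 2) * t : ℝ) : ℂ) by push_cast; ring, ← Complex.ofReal_exp]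
    unfold moll
    push_cast
    ring
  have hM : weilMellin (moll 0) σ = ((∫ t : ℝ, φ t * Real.exp ((σ - 1 / 2) * t) : ℝ) : ℂ) := by
    unfold weilMellin
    rw [e, integral_complex_ofReal]
  rw [hM, Complex.ofReal_re]
  have hφc : Continuous φ := (bump 0).continuous_normed
  have hφs : HasCompactSupport φ := (bump 0).hasCompactSupport_normed
  have hint1 : Integrable fun t : ℝ ↦ φ t * Real.exp ((σ - 1 / 2) * t) :=
    (hφc.mul (by fun_prop)).integrable_of_hasCompactSupport hφs.mul_right
  have hint0 : Integrable fun t : ℝ ↦ φ t * Real.exp (-(1 / 2)) := (bump 0).integrable_normed.mul_const _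
  have hone : ∫ t : ℝ, φ t * Real.exp (-(1 / 2)) = Real.exp (-(1 / 2)) := by
    rw [integral_mul_const, hφ, (bump 0).integral_normed, one_mul]
  rw [← hone]
  refine integral_mono hint0 hint1 fun t ↦ ?_
  have hφ0 : 0 ≤ φ t := (bump 0).nonneg_normed t
  by_cases ht : 1 ≤ |t|
  · have hz : φ t = 0 := by
      have h := moll_zero_eq_zero ht
      unfold moll at h
      exact_mod_cast h
    simp only [hz, zero_mul, le_refl]
  · refine mul_le_mul_of_nonneg_left (Real.exp_le_exp.2 ?_) hφ0
    rw [not_le, abs_lt] at ht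
    have h1 : |(σ - 1 / 2) * t| ≤ 1 / 2 * 1 := by
      rw [abs_mul]; exact mul_le_mul hσ (le_of_lt (abs_lt.2 ⟨ht.1, ht.2⟩)) (abs_nonneg _) (by norm_num)
    linarith [neg_abs_le ((σ - 1 / 2) * t)]

/-! ## §3 The scaled bump -/

/-- The Cramér bump: `φ₀` squeezed to radius `r` and centred at `x₀`. [this track, ATTEMPT-7 §2] -/
def cramerBump (r x₀ : ℝ) : ℝ → ℂ :=
  fun x ↦ moll 0 ((x - x₀) / r)

/-- Off `[x₀ − r, x₀ + r]` the bump vanishes (`r > 0`). [folklore] -/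
theorem cramerBump_eq_zero {r x₀ x : ℝ} (hr : 0 < r) (hx : x ∉ Icc (x₀ - r) (x₀ + r)) :
    cramerBump r x₀ x = 0 := by
  unfold cramerBump
  apply moll_zero_eq_zero
  rw [Set.mem_Icc, not_and_or, not_le, not_le] at hx
  rcases hx with h | h
  · have : (x - x₀) / r < -1 := by rw [div_lt_iff₀ hr]; linarith
    rw [abs_of_neg (by linarith)]; linarith
  · have : 1 < (x - x₀) / r := by rw [lt_div_iff₀ hr]; linarith
    rw [abs_of_pos (by linarith)]; linarith

/-- The Cramér bump is a Weil test function (`r > 0`). [folklore] -/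
theorem isWeilTest_cramerBump {r : ℝ} (hr : 0 < r) (x₀ : ℝ) : IsWeilTest (cramerBump r x₀) := by
  refine ⟨(contDiff_moll 0).comp ((contDiff_id.sub contDiff_const).div_const r), ?_⟩
  exact HasCompactSupport.intro isCompact_Icc (fun x hx ↦ cramerBump_eq_zero hr hx)

/-- Support of the Cramér bump. [folklore] -/
theorem tsupport_cramerBump_subset {r : ℝ} (hr : 0 < r) (x₀ : ℝ) :
    tsupport (cramerBump r x₀) ⊆ Icc (x₀ - r) (x₀ + r) :=
  closure_minimal (fun x hx ↦ by
    by_contra h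
    exact (Function.mem_support.1 hx) (cramerBump_eq_zero hr h)) isClosed_Icc

/-- `∫‖cramerBump r x₀‖² = r·‖φ₀‖₂²` (`r > 0`). [folklore] -/
theorem integral_norm_sq_cramerBump {r : ℝ} (hr : 0 < r) (x₀ : ℝ) :
    ∫ x : ℝ, ‖cramerBump r x₀ x‖ ^ 2 = r * weilNorm2Sq (moll 0) := by
  unfold cramerBump weilNorm2Sq
  have h1 : ∫ x : ℝ, ‖moll 0 ((x - x₀) / r)‖ ^ 2 = ∫ x : ℝ, ‖moll 0 (x / r)‖ ^ 2 :=
    integral_sub_right_eq_self (fun x : ℝ ↦ ‖moll 0 (x / r)‖ ^ 2) x₀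
  rw [h1, Measure.integral_comp_div (fun y : ℝ ↦ ‖moll 0 y‖ ^ 2) r, abs_of_pos hr, smul_eq_mul]

/-- The bump as a translate of a dilate: `cramerBump r x₀ = weilTranslate (φ₀(r⁻¹ ·)) x₀`. [folklore] -/
theorem cramerBump_eq_weilTranslate (r x₀ : ℝ) :
    cramerBump r x₀ = weilTranslate (fun t ↦ moll 0 (r⁻¹ * t)) x₀ := by
  funext x
  simp [cramerBump, weilTranslate, div_eq_inv_mul]

/-- **Mellin transform of the Cramér bump**: `f̂(s) = e^{(s−½)x₀}·r·φ̂₀(½ + r(s − ½))` (`r > 0`). [folklore] -/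
theorem weilMellin_cramerBump {r : ℝ} (hr : 0 < r) (x₀ : ℝ) (s : ℂ) :
    weilMellin (cramerBump r x₀) s =
      cexp ((s - 1 / 2) * x₀) * ((r : ℂ) * weilMellin (moll 0) (1 / 2 + (r : ℂ) * (s - 1 / 2))) := by
  rw [cramerBump_eq_weilTranslate, weilMellin_weilTranslate, weilMellin_comp_mul (moll 0) (inv_pos.2 hr)]
  congr 2
  · push_cast
    rw [inv_inv]
  · congr 1
    push_cast
    have : ((r : ℂ))⁻¹ ≠ 0 := inv_ne_zero (Complex.ofReal_ne_zero.2 hr.ne')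
    field_simp

/-- On the critical line: `‖f̂(½ + it)‖² = r²·‖φ̂₀(½ + i·rt)‖²`. [folklore] -/
theorem norm_sq_weilMellin_cramerBump_half {r : ℝ} (hr : 0 < r) (x₀ t : ℝ) :
    ‖weilMellin (cramerBump r x₀) (1 / 2 + t * I)‖ ^ 2 =
      r ^ 2 * ‖weilMellin (moll 0) (1 / 2 + (r * t : ℝ) * I)‖ ^ 2 := by
  rw [weilMellin_cramerBump hr]
  have e1 : (1 / 2 + (t : ℂ) * I - 1 / 2) * (x₀ : ℂ) = ((t * x₀ : ℝ) : ℂ) * I := by push_cast; ring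
  have e2 : (1 : ℂ) / 2 + (r : ℂ) * (1 / 2 + (t : ℂ) * I - 1 / 2) = 1 / 2 + ((r * t : ℝ) : ℂ) * I := by push_cast; ring
  rw [e1, e2, norm_mul, norm_mul, Complex.norm_exp_ofReal_mul_I, Complex.norm_real, Real.norm_eq_abs, abs_of_pos hr]
  ring

/-- **The polar mass of the bump**: `|f̂(1)|² ≥ e^{x₀ − 1}·r²` (`0 < r ≤ 1`): `f̂(1) = e^{x₀/2}·r·φ̂₀(½ + r/2)` and
`Re φ̂₀(½ + r/2) ≥ e^{−1/2}`. [this track, ATTEMPT-7 §2] -/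
theorem normSq_weilMellin_cramerBump_one_ge {r : ℝ} (hr : 0 < r) (hr1 : r ≤ 1) (x₀ : ℝ) :
    Real.exp (x₀ - 1) * r ^ 2 ≤ Complex.normSq (weilMellin (cramerBump r x₀) 1) := by
  rw [weilMellin_cramerBump hr]
  have e1 : ((1 : ℂ) - 1 / 2) * (x₀ : ℂ) = ((x₀ / 2 : ℝ) : ℂ) := by push_cast; ring
  have e2 : (1 : ℂ) / 2 + (r : ℂ) * (1 - 1 / 2) = (((1 / 2 + r / 2 : ℝ)) : ℂ) := by push_cast; ring
  rw [e1, e2]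
  set M := weilMellin (moll 0) ((1 / 2 + r / 2 : ℝ) : ℂ) with hM
  have hre : Real.exp (-(1 / 2)) ≤ M.re :=
    exp_neg_half_le_re_weilMellin_moll_zero_real (by rw [show (1:ℝ)/2 + r/2 - 1/2 = r/2 by ring, abs_of_pos (by positivity)]; linarith)
  have hprod_re : (cexp ((x₀ / 2 : ℝ) : ℂ) * ((r : ℂ) * M)).re = Real.exp (x₀ / 2) * r * M.re := by
    rw [Complex.mul_re, Complex.exp_ofReal_re, Complex.exp_ofReal_im, Complex.mul_re, Complex.mul_im,
      Complex.ofReal_re, Complex.ofReal_im]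
    ring
  have hge : (Real.exp (x₀ / 2) * r * M.re) ^ 2 ≤ Complex.normSq (cexp ((x₀ / 2 : ℝ) : ℂ) * ((r : ℂ) * M)) := by
    rw [← hprod_re, Complex.normSq_apply]
    nlinarith [sq_nonneg ((cexp ((x₀ / 2 : ℝ) : ℂ) * ((r : ℂ) * M)).im)]
  have h1 : Real.exp (x₀ / 2) * r * Real.exp (-(1 / 2)) ≤ Real.exp (x₀ / 2) * r * M.re :=
    mul_le_mul_of_nonneg_left hre (by positivity)
  have h2 : (Real.exp (x₀ / 2) * r * Real.exp (-(1 / 2))) ^ 2 = Real.exp (x₀ - 1) * r ^ 2 := by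
    have : Real.exp (x₀ - 1) = (Real.exp (x₀ / 2) * Real.exp (-(1 / 2))) ^ 2 := by
      rw [← Real.exp_add, sq, ← Real.exp_add]; ring_nf
    rw [this]; ring
  calc Real.exp (x₀ - 1) * r ^ 2 = (Real.exp (x₀ / 2) * r * Real.exp (-(1 / 2))) ^ 2 := h2.symm
    _ ≤ (Real.exp (x₀ / 2) * r * M.re) ^ 2 := by
        exact pow_le_pow_left₀ (by positivity) h1 2
    _ ≤ _ := hge

/-! ## §4 The energy ceiling -/

/-- **Energy ceiling of a narrow bump.** For `0 < r ≤ 1/4` and any centre `x₀`: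
`Re Q(cramerBump r x₀) ≤ (log(1/r) + cramerEnergyConst)·∫‖cramerBump r x₀‖²`. [this track, ATTEMPT-7 §5; cite: Bombieri2000, §12 (12.3)–(12.5) for E(g)] -/
theorem re_weilQuadratic_cramerBump_le {r : ℝ} (hr : 0 < r) (hr4 : r ≤ 1 / 4) (x₀ : ℝ) :
    (weilQuadratic (cramerBump r x₀)).re ≤
      (Real.log (1 / r) + cramerEnergyConst) * ∫ x : ℝ, ‖cramerBump r x₀ x‖ ^ 2 := by
  set f₀ : ℝ → ℂ := cramerBump r 0 with hf₀
  have hf₀t : IsWeilTest f₀ := isWeilTest_cramerBump hr 0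
  have htrans : weilQuadratic (cramerBump r x₀) = weilQuadratic f₀ := by
    have e : cramerBump r x₀ = fun x ↦ f₀ (x - x₀) := by
      funext x; simp [hf₀, cramerBump]
    rw [e, weilQuadratic_translate]
  have hN : ∫ x : ℝ, ‖cramerBump r x₀ x‖ ^ 2 = r * weilNorm2Sq (moll 0) := integral_norm_sq_cramerBump hr x₀
  have hN0 : ∫ x : ℝ, ‖f₀ x‖ ^ 2 = r * weilNorm2Sq (moll 0) := integral_norm_sq_cramerBump hr 0
  set N := r * weilNorm2Sq (moll 0) with hNdef
  have hφ := half_le_weilNorm2Sq_moll_zero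
  have hNr : r / 2 ≤ N := by rw [hNdef]; nlinarith
  have hNpos : 0 < N := by linarith
  rw [htrans, hN]
  have hsupp0 : tsupport f₀ ⊆ Icc (-r) r := by
    have := tsupport_cramerBump_subset hr 0
    simpa using this
  have hl2 := Real.log_two_gt_d9
  have hsupp2 : tsupport f₀ ⊆ Icc (-(Real.log 2 / 2)) (Real.log 2 / 2) :=
    hsupp0.trans (Icc_subset_Icc (by linarith) (by linarith))
  rw [weilQuadratic_re_eq_weilArchQuadratic hf₀t hsupp2, weilArchQuadratic_eq]
  have hM : ∀ s : ℂ, ‖weilMellin f₀ s‖ = r * ‖weilMellin (moll 0) (1 / 2 + (r : ℂ) * (s - 1 / 2))‖ := by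
    intro s
    rw [hf₀, weilMellin_cramerBump hr, norm_mul, norm_mul, Complex.norm_real, Real.norm_eq_abs, abs_of_pos hr]
    simp
  have hM0 : ‖weilMellin f₀ 0‖ ≤ r * Real.exp 1 := by
    rw [hM 0]
    refine mul_le_mul_of_nonneg_left ((norm_weilMellin_moll_le 0 _).trans (Real.exp_le_exp.2 ?_)) hr.le
    have : ((1 : ℂ) / 2 + (r : ℂ) * (0 - 1 / 2)).re - 1 / 2 = -(r / 2) := by
      simp [Complex.mul_re]; ring
    rw [this, abs_neg, abs_of_pos (by positivity)]; linarith
  have hM1 : ‖weilMellin f₀ 1‖ ≤ r * Real.exp 1 := by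
    rw [hM 1]
    refine mul_le_mul_of_nonneg_left ((norm_weilMellin_moll_le 0 _).trans (Real.exp_le_exp.2 ?_)) hr.le
    have : ((1 : ℂ) / 2 + (r : ℂ) * (1 - 1 / 2)).re - 1 / 2 = r / 2 := by
      simp [Complex.mul_re]; ring
    rw [this, abs_of_pos (by positivity)]; linarith
  have hpolar : 2 * (weilMellin f₀ 0 * conj (weilMellin f₀ 1)).re ≤ 2 * (r * Real.exp 1) ^ 2 := by
    have h1 : (weilMellin f₀ 0 * conj (weilMellin f₀ 1)).re ≤ ‖weilMellin f₀ 0 * conj (weilMellin f₀ 1)‖ :=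
      Complex.re_le_norm _
    rw [norm_mul, Complex.norm_conj] at h1
    have h2 : ‖weilMellin f₀ 0‖ * ‖weilMellin f₀ 1‖ ≤ (r * Real.exp 1) * (r * Real.exp 1) :=
      mul_le_mul hM0 hM1 (norm_nonneg _) (by positivity)
    nlinarith
  set G : ℝ → ℝ := fun t ↦ ‖weilMellin f₀ (1 / 2 + t * I)‖ ^ 2 with hG
  set F : ℝ → ℝ := fun u ↦ ‖weilMellin (moll 0) (1 / 2 + u * I)‖ ^ 2 * Real.log (1 + |u|) with hF
  have hGF : (fun t : ℝ ↦ G t * Real.log (1 + |r * t|)) = fun t : ℝ ↦ r ^ 2 * F (r * t) := by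
    funext t
    simp only [hG, hF, hf₀]
    rw [norm_sq_weilMellin_cramerBump_half hr 0 t]
    ring
  have hintF : Integrable F := integrable_norm_sq_weilMellin_mul_log (isWeilTest_moll 0)
  have hint2 : Integrable fun t : ℝ ↦ G t * Real.log (1 + |r * t|) := by
    rw [hGF]
    exact (hintF.comp_mul_left' hr.ne').const_mul _
  have hPl : ∫ t : ℝ, G t = 2 * π * N := by
    rw [hG, integral_norm_sq_weilMellin_half_line hf₀t]
    unfold weilNorm2Sq
    rw [hN0]
  have hint_rho := integrable_norm_sq_weilMellin_mul_reDigammaQuarter hf₀t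
  have hint_log := integrable_norm_sq_weilMellin_mul_log hf₀t
  have hint_G : Integrable G := integrable_norm_sq_weilMellin_half_line hf₀t
  -- step 1: ρ ≤ log(1+|t|) + 3
  have hstep1 : ∫ t : ℝ, G t * Literature.Analysis.SpecialFunctions.reDigammaQuarter t ≤
      ∫ t : ℝ, (G t * Real.log (1 + |t|) + 3 * G t) := by
    refine integral_mono hint_rho (hint_log.add (hint_G.const_mul 3)) fun t ↦ ?_
    have := reDigammaQuarter_le_log_add_three t
    have hG0 : 0 ≤ G t := sq_nonneg _
    nlinarith
  -- step 2: log(1+|t|) ≤ log(1/r) + log(1 + |r t|)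
  have hstep2 : ∫ t : ℝ, (G t * Real.log (1 + |t|) + 3 * G t) ≤
      ∫ t : ℝ, (G t * Real.log (1 + |r * t|) + (Real.log (1 / r) + 3) * G t) := by
    refine integral_mono (hint_log.add (hint_G.const_mul 3)) (hint2.add (hint_G.const_mul _)) fun t ↦ ?_
    have hG0 : 0 ≤ G t := sq_nonneg _
    have hlog : Real.log (1 + |t|) ≤ Real.log (1 / r) + Real.log (1 + |r * t|) := by
      rw [← Real.log_mul (by positivity) (by positivity)]
      refine Real.log_le_log (by positivity) ?_
      rw [abs_mul, abs_of_pos hr]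
      have : 1 / r * (1 + r * |t|) = 1 / r + |t| := by field_simp
      rw [this]
      have : (1 : ℝ) ≤ 1 / r := by rw [le_div_iff₀ hr]; linarith
      linarith
    nlinarith
  -- step 3: the substitution u = r t
  have hstep3 : ∫ t : ℝ, G t * Real.log (1 + |r * t|) = r * mollLogMoment := by
    rw [hGF, integral_const_mul, Measure.integral_comp_mul_left F r, abs_of_pos (inv_pos.2 hr), smul_eq_mul]
    have hLF : mollLogMoment = ∫ u : ℝ, F u := rfl
    rw [hLF]
    field_simp
  have harch : 1 / (2 * π) * ∫ t : ℝ, G t * Literature.Analysis.SpecialFunctions.reDigammaQuarter t ≤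
      (Real.log (1 / r) + 3) * N + r * mollLogMoment / (2 * π) := by
    have h12 := hstep1.trans hstep2
    rw [integral_add hint2 (hint_G.const_mul _), hstep3, integral_const_mul, hPl] at h12
    have hπ : 0 < 2 * π := by positivity
    calc 1 / (2 * π) * ∫ t : ℝ, G t * Literature.Analysis.SpecialFunctions.reDigammaQuarter t
        ≤ 1 / (2 * π) * (r * mollLogMoment + (Real.log (1 / r) + 3) * (2 * π * N)) :=
          mul_le_mul_of_nonneg_left h12 (by positivity)
      _ = (Real.log (1 / r) + 3) * N + r * mollLogMoment / (2 * π) := by field_simp; ring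
  -- assemble: E = polar − log π N + arch ≤ 2e²r² + (log(1/r)+3)N + r L/(2π) ≤ (log(1/r) + C) N
  have hlogπ : 0 ≤ Real.log π := Real.log_nonneg (by linarith [Real.pi_gt_three])
  have hL := mollLogMoment_nonneg
  have hr1 : r ≤ 1 := by linarith
  have he : Real.exp 1 ≤ 2.7182818286 := Real.exp_one_lt_d9.le
  have he0 : 0 < Real.exp 1 := Real.exp_pos 1
  have hA : 2 * (r * Real.exp 1) ^ 2 ≤ 4 * Real.exp 1 * N := by
    have h1 : r * Real.exp 1 ≤ 1 := by nlinarith [mul_nonneg (sub_nonneg.2 hr4) he0.le]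
    calc 2 * (r * Real.exp 1) ^ 2 = (2 * r * Real.exp 1) * (r * Real.exp 1) := by ring
      _ ≤ (2 * r * Real.exp 1) * 1 := mul_le_mul_of_nonneg_left h1 (by positivity)
      _ = 4 * Real.exp 1 * (r / 2) := by ring
      _ ≤ 4 * Real.exp 1 * N := mul_le_mul_of_nonneg_left hNr (by positivity)
  have hB : r * mollLogMoment / (2 * π) ≤ mollLogMoment / π * N := by
    have hπ : 0 < π := Real.pi_pos
    rw [div_le_iff₀ (by positivity)]
    have : mollLogMoment / π * N * (2 * π) = 2 * mollLogMoment * N := by field_simp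
    rw [this]
    nlinarith [hNr, hL]
  have hGdef : (∫ t : ℝ, ‖weilMellin f₀ (1 / 2 + t * I)‖ ^ 2 *
      (Complex.digamma (1 / 4 + t / 2 * I)).re) = ∫ t : ℝ, G t * Literature.Analysis.SpecialFunctions.reDigammaQuarter t := rfl
  rw [hGdef, hN0]
  unfold cramerEnergyConst
  nlinarith [hpolar, harch, hA, hB, hlogπ, hNpos]

end Summit.RiemannHypothesis.RiemannHypothesis.Theorems.Handoff
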